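import Literature.NumberTheory.EllipticCurves.CyclotomicIwasawaMainTheoremIrreducibleMuZeroProofs
import Summits.BirchSwinnertonDyer.BirchSwinnertonDyer.Theorems.Rank1ResidualX9TwistCriterion
import Summits.BirchSwinnertonDyer.Rank1Residual.GreenbergMuConjecture
import Summits.BirchSwinnertonDyer.Rank1Residual.X9.TwistStability
import Literature.NumberTheory.EllipticCurves.KatoRankBoundProofs
import HarnessLib

/-!
# Class X9, print road «BCS 2025 under (irr_ℚ) only»: Greenberg's `μ = 0` ⟹
# `IntegralMainConjectureOnClassX9` ⟹ the K6 leaf `BSDpOnClassX9` — CLASS LEVEL, with NO analytic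
# `μ = 0` certificate and NO Kato package

Cell `pub/bsd-print-x9` (D-0131 (2) print tier), seat `bsd-print-x9-p1`; consumer of
`Literature/NumberTheory/EllipticCurves/CyclotomicIwasawaMainTheoremIrreducibleMuZeroProofs.lean`
(the per-pair theorem
`charIdeal_eq_padicLFunction_of_mu_eq_zero_of_twists`: BCS Thm. 1.1.2 (a) ×4 + the integral
four-fold product divisibility (5.3) + Greenberg–Vatsal Prop. 3.7 + `μ = 0` at `E` and its three
base-change twists ⟹ `ch X = (L_p)` in `Λ`). THEOREMS ONLY; nothing booked; labels unchanged.

* §3 `integralMainConjectureOnClassX9_of_greenbergMuConjectureIrreducible` — Greenberg's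
  Conjecture 1.11 in its irreducible form (typed leaf
  `Summit.BirchSwinnertonDyer.Rank1Residual.GreenbergMuConjectureIrreducible`) + the published
  binders ⟹ `IntegralMainConjectureOnClassX9` (twists of an irreducible `E[p]` are irreducible;
  the leaf's torsion guard is BCS (a)'s first clause);
  `integralMainConjectureOnClassX9_of_muZeroOnClassX9` — the same from `μ = 0` ON CLASS X9 ONLY,
  in the cell's per-pair binder shape `hμ` (X9 is closed under twists unramified at `p`,
  `Rank1Residual.X9.classX9_of_smul_eq_quadraticTwist`) — the tightest residual of this road,
  implied by the K6 inputs `KatoMuTransfer ∧ AnalyticMuZeroOnClassX9`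
  (`mu_eq_zero_of_katoMuTransfer_of_analyticMuZero`).
* §4 `bsdpOnClassX9_of_greenbergMuConjectureIrreducible`, `bsdpOnClassX9_of_muZeroOnClassX9` —
  the K6 leaf by the kernel bridge `bsdpOnClassX9_of_integralMainConjectureOnClassX9` with its
  PUBLISHED binders and, on the rank-`1` pairs only, the Schneider certificate C3 (route item
  19631). Compared with `bsdpOnClassX9_of_katoMuTransfer`: no `KatoMuTransfer` (F1, aside 19843)
  and no `AnalyticMuZeroOnClassX9` (19630).
* §5 `analyticMuZeroOnClassX9_of_greenbergMuConjectureIrreducible`, `…_of_muZeroOnClassX9` — the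
  K6 analytic crux `AnalyticMuZeroOnClassX9` (item 19630 by name) FOLLOWS from the algebraic `μ = 0`
  on X9 modulo BCS (a) + (5.3): the companion direction of K6's `KatoMuTransfer`.
* §6 `bsdp_of_greenbergMuConjectureIrreducible_of_analyticRank_eq_zero` — rank `0`, per pair,
  Schneider-free: Greenberg + published binders ⟹ Miller's `BSD(E,p)` at every X9 pair with
  `r_an = 0` (the cell's `Rank1Residual.X9.bsdp_of_mu_eq_zero` fed by §3/§5).

Honest status: CONDITIONAL (Greenberg OPEN; BCS flagged
`BCS25-IMC-equiv@BSTW+Wan15-Thm3@Fuj06(unpublished)+Hid04-gap`); beyond-print theorem: no; the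
class label is unchanged. References: [GreenbergLNM1716] Conj. 1.11, Thm. 4.1;
[BurungaleCastellaSkinner2025] Thm. 1.1.2 (a), display (5.3), Lemma 5.2.3; [PerrinRiou1987];
[Schneider1985]; [Miller2011LMS] Def. 1.1.
-/

-- the summit and its single problem are both named `BirchSwinnertonDyer` (registry layout D-0017)
set_option linter.dupNamespace false

set_option autoImplicit false

noncomputable section

open scoped Classical MatrixGroups ModularForm

open CongruenceSubgroup WeierstrassCurve Field
open Literature.NumberTheory.EllipticCurves Literature.NumberTheory.EllipticCurves.ModularForms
open Literature.NumberTheory.EllipticCurves.BurungaleCastellaSkinner2025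
  (display53_prod_charIdeal_le_prod_padicLFunction)

namespace Summit.BirchSwinnertonDyer.BirchSwinnertonDyer.Rank1Residual

/-! ### §3 Class level: Greenberg's Conjecture 1.11 ⟹ `IntegralMainConjectureOnClassX9` -/

/-- **Greenberg's `μ`-conjecture (irreducible form, the typed leaf
`GreenbergMuConjectureIrreducible`) + the published binders ⟹ the INTEGRAL cyclotomic main
conjecture on class X9 (`IntegralMainConjectureOnClassX9`, the typed rank-`0` missing input of
X9)** — with NO analytic `μ = 0` certificate and NO Kato package: Burungale–Castella–Skinner (a) +
display (5.3) + Greenberg–Vatsal Prop. 3.7 + modularity + the period unit. The conjecture is used at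
the X9 pair and at the three auxiliary twists `E^K, E^F, E^{FK}` of Lemma 5.2.3 (good ordinary at
`p ∤ 2 d_K d_F`, `E^d[p] ≅ E[p] ⊗ χ_d` irreducible), its torsion guard discharged by (a).
[cite: GreenbergLNM1716, §1 Conj. 1.11]
[cite: BurungaleCastellaSkinner2025, Thm. 1.1.2 (a) and display (5.3) (pp. 2, 10 of arXiv:2405.00270v2)] -/
theorem integralMainConjectureOnClassX9_of_greenbergMuConjectureIrreducible
    (hGrμ : Summit.BirchSwinnertonDyer.Rank1Residual.GreenbergMuConjectureIrreducible)
    (hBCS : burungale_castella_skinner_charIdeal_eq_padicLFunction)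
    (h53 : display53_prod_charIdeal_le_prod_padicLFunction)
    (hmod : exists_isNewformOf) (h5 : realPeriodRat_eq_unit_mul_plusPeriod) :
    IntegralMainConjectureOnClassX9 := by
  intro W _ _ p _ κ γ N _ f hX9 hκ hγ hγ' hf D
  obtain ⟨-, hp, hgood, hord, hirr, -⟩ := id hX9
  refine charIdeal_eq_padicLFunction_of_mu_eq_zero_of_twists hBCS h53 hmod h5 W p hp hgood hord hirr
    κ γ hκ hγ hγ' f hf D ?_ ?_
  · exact hGrμ W p κ γ hκ hγ hirr D (hBCS W p κ γ f hp hgood hord hirr hκ hγ hγ' hf D).1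
  · intro d W' _ _ hd _ hC D' hD'
    obtain ⟨C, hC⟩ := hC
    have hd0 : (d : ℚ) ≠ 0 := by exact_mod_cast hd.ne_zero
    exact hGrμ W' p κ γ hκ hγ
      ((W.hasIrreducibleModPGaloisRep_iff_of_smul_eq_quadraticTwist W' hd0 hC p).mpr hirr) D' hD'


/-- **The same from `μ = 0` ON CLASS X9 ONLY** — the tightest residual of this road. Hypothesis
`hμX9`: at every X9 pair `(V, p)`, `μ(X(V/ℚ_∞)) = 0` for all cyclotomic data — EXACTLY the per-pair
binder `hμ` of the cell's X9 kernels (`Rank1Residual.X9.bsdp_of_mu_eq_zero…`,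
`mu_eq_zero_of_katoMuTransfer_of_analyticMuZero`), i.e. Greenberg's Conjecture 1.11 restricted to
class X9; it is implied by the K6 inputs `KatoMuTransfer ∧ AnalyticMuZeroOnClassX9`
(`mu_eq_zero_of_katoMuTransfer_of_analyticMuZero`) and by `GreenbergMuConjectureIrreducible`. Since
X9 is closed under the quadratic twists unramified at `p`
(`Rank1Residual.X9.classX9_of_smul_eq_quadraticTwist`), the three auxiliary twists of an X9 pair are
X9 pairs and §2 applies. Conclusion: `IntegralMainConjectureOnClassX9`.
[cite: GreenbergLNM1716, §1 Conj. 1.11]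
[cite: BurungaleCastellaSkinner2025, Thm. 1.1.2 (a) and display (5.3) (pp. 2, 10 of arXiv:2405.00270v2)] -/
theorem integralMainConjectureOnClassX9_of_muZeroOnClassX9
    (hμX9 : ∀ (V : WeierstrassCurve ℚ) [V.IsElliptic] [V.IsGloballyMinimal] (p : ℕ) [Fact p.Prime],
      ClassX9 V p → ∀ (κ : ZpExtension ℚ p) (γ : Field.absoluteGaloisGroup ℚ),
        κ.IsCyclotomic → κ.IsTopGenerator γ → IsCyclotomicVariable p γ →
        ∀ D : V.SelmerDualData κ γ, D.mu = 0)
    (hBCS : burungale_castella_skinner_charIdeal_eq_padicLFunction)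
    (h53 : display53_prod_charIdeal_le_prod_padicLFunction)
    (hmod : exists_isNewformOf) (h5 : realPeriodRat_eq_unit_mul_plusPeriod) :
    IntegralMainConjectureOnClassX9 := by
  intro W _ _ p _ κ γ N _ f hX9 hκ hγ hγ' hf D
  obtain ⟨-, hp, hgood, hord, hirr, -⟩ := id hX9
  refine charIdeal_eq_padicLFunction_of_mu_eq_zero_of_twists hBCS h53 hmod h5 W p hp hgood hord hirr
    κ γ hκ hγ hγ' f hf D (hμX9 W p hX9 κ γ hκ hγ hγ' D) ?_
  intro d W' _ _ hd hpd hC D' _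
  obtain ⟨C, hC⟩ := hC
  exact hμX9 W' p
    (Summit.BirchSwinnertonDyer.Rank1Residual.X9.classX9_of_smul_eq_quadraticTwist W W' p hX9 hd hC
      hpd)
    κ γ hκ hγ hγ' D'

/-! ### §4 The K6 leaf from Greenberg's conjecture (no analytic `μ`, no Kato package) -/

/-- **`BSDpOnClassX9` from Greenberg's Conjecture 1.11, both analytic ranks** — the Greenberg-
conditional display of the K6 leaf through THIS road: Greenberg (irreducible form) ⟹
`IntegralMainConjectureOnClassX9` (§3) ⟹ the leaf by the kernel bridge
`bsdpOnClassX9_of_integralMainConjectureOnClassX9` with its PUBLISHED binders (Greenberg 1999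
Thm. 4.1 `hGr`, the period unit `h5`, Schneider 1985 `hS`, Perrin-Riou 1987 `hPR`, modularity
`hmodP`/`hmodL`/`hmod`, Gross–Zagier–Kolyvagin `hGZK`, BCS (a) `hBCS`, BCS (5.3) `h53`) and, on
the rank-`1` pairs only, the Schneider certificate C3 (`hC3`, route item 19631). Compared with
`bsdpOnClassX9_of_katoMuTransfer`: no `KatoMuTransfer` (F1) and no `AnalyticMuZeroOnClassX9`
(19630). CONDITIONAL (Greenberg OPEN; BCS flagged); nothing booked.
[cite: GreenbergLNM1716, §1 Conj. 1.11 and Thm. 4.1]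
[cite: BurungaleCastellaSkinner2025, Thm. 1.1.2 (a), display (5.3)]
[cite: Miller2011LMS, §1 and Def. 1.1] -/
theorem bsdpOnClassX9_of_greenbergMuConjectureIrreducible
    (hGrμ : Summit.BirchSwinnertonDyer.Rank1Residual.GreenbergMuConjectureIrreducible)
    (hBCS : burungale_castella_skinner_charIdeal_eq_padicLFunction)
    (h53 : display53_prod_charIdeal_le_prod_padicLFunction)
    (hmod : exists_isNewformOf) (h5 : realPeriodRat_eq_unit_mul_plusPeriod)
    (hGr : greenberg_charValue_rankZero)
    (hS : Schneider1985_order_charGenerator) (hPR : perrinRiou_rankOne_leadingTerms)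
    (hmodP : nonempty_modularParametrizationData) (hmodL : hasEntireLFunction_rat)
    (hGZK : rank_eq_analyticRank_of_analyticRank_le_one)
    (hC3 : ∀ (W : WeierstrassCurve ℚ) [W.IsElliptic] [W.IsGloballyMinimal] (p : ℕ) [Fact p.Prime],
      ClassX9 W p → W.analyticRank = 1 →
        ∀ Dh : PAdicHeightData W p, Dh.IsCanonical → SchneiderConjecture Dh) :
    BSDpOnClassX9 :=
  bsdpOnClassX9_of_integralMainConjectureOnClassX9 hGr h5 hS hPR hmodP hmodL hGZK
    (integralMainConjectureOnClassX9_of_greenbergMuConjectureIrreducible hGrμ hBCS h53 hmod h5) hC3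


/-- **`BSDpOnClassX9` from `μ = 0` on class X9 alone** (+ the published binders, + the Schneider
certificate C3 on the rank-`1` pairs): the leaf's display along THIS road with the tightest open
input, the per-pair binder shape `hμ` quantified over the class (§3,
`integralMainConjectureOnClassX9_of_muZeroOnClassX9`). Compared with
`bsdpOnClassX9_of_katoMuTransfer`
(K6): its two cell inputs imply `hμX9`; here neither Kato's package nor the analytic certificate is
consumed. CONDITIONAL; nothing booked. [cite: GreenbergLNM1716, §1 Conj. 1.11 and Thm. 4.1]
[cite: BurungaleCastellaSkinner2025, Thm. 1.1.2 (a), display (5.3)]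
[cite: Miller2011LMS, §1 and Def. 1.1] -/
theorem bsdpOnClassX9_of_muZeroOnClassX9
    (hμX9 : ∀ (V : WeierstrassCurve ℚ) [V.IsElliptic] [V.IsGloballyMinimal] (p : ℕ) [Fact p.Prime],
      ClassX9 V p → ∀ (κ : ZpExtension ℚ p) (γ : Field.absoluteGaloisGroup ℚ),
        κ.IsCyclotomic → κ.IsTopGenerator γ → IsCyclotomicVariable p γ →
        ∀ D : V.SelmerDualData κ γ, D.mu = 0)
    (hBCS : burungale_castella_skinner_charIdeal_eq_padicLFunction)
    (h53 : display53_prod_charIdeal_le_prod_padicLFunction)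
    (hmod : exists_isNewformOf) (h5 : realPeriodRat_eq_unit_mul_plusPeriod)
    (hGr : greenberg_charValue_rankZero)
    (hS : Schneider1985_order_charGenerator) (hPR : perrinRiou_rankOne_leadingTerms)
    (hmodP : nonempty_modularParametrizationData) (hmodL : hasEntireLFunction_rat)
    (hGZK : rank_eq_analyticRank_of_analyticRank_le_one)
    (hC3 : ∀ (W : WeierstrassCurve ℚ) [W.IsElliptic] [W.IsGloballyMinimal] (p : ℕ) [Fact p.Prime],
      ClassX9 W p → W.analyticRank = 1 →
        ∀ Dh : PAdicHeightData W p, Dh.IsCanonical → SchneiderConjecture Dh) :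
    BSDpOnClassX9 :=
  bsdpOnClassX9_of_integralMainConjectureOnClassX9 hGr h5 hS hPR hmodP hmodL hGZK
    (integralMainConjectureOnClassX9_of_muZeroOnClassX9 hμX9 hBCS h53 hmod h5) hC3


/-! ### §5 The K6 analytic crux from Greenberg's algebraic conjecture -/

/-- **Greenberg's ALGEBRAIC `μ`-conjecture (irreducible form) ⟹ the ANALYTIC `μ = 0` on class X9**
(`AnalyticMuZeroOnClassX9`, route item 19630 `AnalyticMuZeroX9` of `SmallImageMuTransfer` by name):
at an X9 pair, §3 gives `ch X = (g)` with `ι g = L_p(f, α)` for the cyclotomic datum of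
`exists_isCyclotomic_isTopGenerator_isCyclotomicVariable_holds`, Greenberg gives `μ(g) = 0`, i.e. a
unit coefficient of `ι g = L_p(f, α)` (`GreenbergVatsal2000.hasUnitContent_iff_exists_norm_coeff_map_eq_one`).
The converse transfer of the K6 route (`KatoMuTransfer`: analytic ⟹ algebraic, modulo Kato's
package) thus has an algebraic ⟹ analytic companion modulo BCS (a) + (5.3). CONDITIONAL; nothing
booked. [cite: GreenbergLNM1716, §1 Conj. 1.11] [cite: GreenbergVatsal2000, p. 2, (1)–(2)]
[cite: BurungaleCastellaSkinner2025, Thm. 1.1.2 (a), display (5.3)] -/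
theorem analyticMuZeroOnClassX9_of_greenbergMuConjectureIrreducible
    (hGrμ : Summit.BirchSwinnertonDyer.Rank1Residual.GreenbergMuConjectureIrreducible)
    (hBCS : burungale_castella_skinner_charIdeal_eq_padicLFunction)
    (h53 : display53_prod_charIdeal_le_prod_padicLFunction)
    (hmod : exists_isNewformOf) (h5 : realPeriodRat_eq_unit_mul_plusPeriod) :
    AnalyticMuZeroOnClassX9 := by
  intro W _ _ p _ N _ f hX9 hf
  obtain ⟨-, -, -, -, hirr, -⟩ := id hX9
  obtain ⟨κ, hκ, γ, hγ, hγ'⟩ := exists_isCyclotomic_isTopGenerator_isCyclotomicVariable_holds p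
  obtain ⟨htors, g, hchar, hιg⟩ :=
    integralMainConjectureOnClassX9_of_greenbergMuConjectureIrreducible hGrμ hBCS h53 hmod h5 W p κ γ
      f hX9 hκ hγ hγ' hf (W.selmerDualData κ hγ)
  haveI : Module.Finite (IwasawaAlgebra p) (W.selmerDualData κ hγ).X :=
    (W.selmerDualData κ hγ).module_finite_holds hγ
  have hg : GreenbergVatsal2000.HasUnitContent g :=
    (GreenbergVatsal2000.mu_eq_zero_iff_hasUnitContent _ htors hchar).mp
      (hGrμ W p κ γ hκ hγ hirr _ htors)
  rw [GreenbergVatsal2000.hasUnitContent_iff_exists_norm_coeff_map_eq_one, hιg] at hg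
  exact hg

/-- **`μ = 0` on class X9 (the `hμ` shape) ⟹ the ANALYTIC `μ = 0` on class X9** — the same through
`integralMainConjectureOnClassX9_of_muZeroOnClassX9`: on X9, modulo BCS (a) + (5.3), Greenberg's
conjecture on the algebraic side implies it on the analytic side (K6's `KatoMuTransfer` is the
converse modulo Kato's package). [cite: GreenbergLNM1716, §1 Conj. 1.11]
[cite: GreenbergVatsal2000, p. 2, (1)–(2)] [cite: BurungaleCastellaSkinner2025, Thm. 1.1.2 (a), display (5.3)] -/
theorem analyticMuZeroOnClassX9_of_muZeroOnClassX9
    (hμX9 : ∀ (V : WeierstrassCurve ℚ) [V.IsElliptic] [V.IsGloballyMinimal] (p : ℕ) [Fact p.Prime],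
      ClassX9 V p → ∀ (κ : ZpExtension ℚ p) (γ : Field.absoluteGaloisGroup ℚ),
        κ.IsCyclotomic → κ.IsTopGenerator γ → IsCyclotomicVariable p γ →
        ∀ D : V.SelmerDualData κ γ, D.mu = 0)
    (hBCS : burungale_castella_skinner_charIdeal_eq_padicLFunction)
    (h53 : display53_prod_charIdeal_le_prod_padicLFunction)
    (hmod : exists_isNewformOf) (h5 : realPeriodRat_eq_unit_mul_plusPeriod) :
    AnalyticMuZeroOnClassX9 := by
  intro W _ _ p _ N _ f hX9 hf
  obtain ⟨κ, hκ, γ, hγ, hγ'⟩ := exists_isCyclotomic_isTopGenerator_isCyclotomicVariable_holds p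
  obtain ⟨htors, g, hchar, hιg⟩ :=
    integralMainConjectureOnClassX9_of_muZeroOnClassX9 hμX9 hBCS h53 hmod h5 W p κ γ f hX9 hκ hγ
      hγ' hf (W.selmerDualData κ hγ)
  haveI : Module.Finite (IwasawaAlgebra p) (W.selmerDualData κ hγ).X :=
    (W.selmerDualData κ hγ).module_finite_holds hγ
  have hg : GreenbergVatsal2000.HasUnitContent g :=
    (GreenbergVatsal2000.mu_eq_zero_iff_hasUnitContent _ htors hchar).mp
      (hμX9 W p hX9 κ γ hκ hγ hγ' _)
  rw [GreenbergVatsal2000.hasUnitContent_iff_exists_norm_coeff_map_eq_one, hιg] at hg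
  exact hg


/-! ### §6 Rank 0, Schneider-free: `BSD(E,p)` at every X9 pair of analytic rank `0` from Greenberg -/

/-- **Class X9, analytic rank `0`: Greenberg's Conjecture 1.11 (irreducible form) + the published
binders ⟹ Miller's `BSD(E,p)`** — no Schneider certificate (rank `0`), no analytic certificate
(supplied by §5), no Kato package. The cell's rank-`0` kernel `Rank1Residual.X9.bsdp_of_mu_eq_zero`
(BCS (a) `hBCS`, Greenberg 1999 Thm. 4.1 `hGr`, period unit `h5`, modularity `hmodP`/`hmodL`,
Gross–Zagier–Kolyvagin `hGZK`) fed with `hμ` := Greenberg at the pair (torsion guard from BCS (a)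
at the newform of `hmod`) and `hcert` := §5 in the `ϖ`-normalisation (`‖ϖ‖ = 1`,
`norm_periodRatio_eq_one`). CONDITIONAL; nothing booked.
[cite: GreenbergLNM1716, §1 Conj. 1.11 and Thm. 4.1] [cite: Miller2011LMS, §1 and Def. 1.1]
[cite: CastellaEtAl2021, Thm. 5.1.4 and its proof (§5.1.3)] -/
theorem bsdp_of_greenbergMuConjectureIrreducible_of_analyticRank_eq_zero
    (hGrμ : Summit.BirchSwinnertonDyer.Rank1Residual.GreenbergMuConjectureIrreducible)
    (hBCS : burungale_castella_skinner_charIdeal_eq_padicLFunction)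
    (h53 : display53_prod_charIdeal_le_prod_padicLFunction)
    (hmod : exists_isNewformOf) (h5 : realPeriodRat_eq_unit_mul_plusPeriod)
    (hGr : greenberg_charValue_rankZero)
    (hmodP : nonempty_modularParametrizationData) (hmodL : hasEntireLFunction_rat)
    (hGZK : rank_eq_analyticRank_of_analyticRank_le_one)
    (W : WeierstrassCurve ℚ) [W.IsElliptic] [W.IsGloballyMinimal] (p : ℕ) [Fact p.Prime]
    (hX9 : ClassX9 W p) (hr : W.analyticRank = 0) : BSDp W p := by
  obtain ⟨hcm, hp, hgood, hord, hirr, hns⟩ := id hX9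
  have hX9c : Literature.NumberTheory.EllipticCurves.Rank1Residual.ClassX9 W p :=
    ⟨hcm, ⟨hgood, hord⟩, hp, hirr, hns, fun h1 => by omega⟩
  have hA := analyticMuZeroOnClassX9_of_greenbergMuConjectureIrreducible hGrμ hBCS h53 hmod h5
  haveI : NeZero (W.conductorNorm ℤ) := ⟨(W.conductorNorm_pos_holds).ne'⟩
  obtain ⟨f₀, hf₀⟩ := hmod W
  refine Literature.NumberTheory.EllipticCurves.Rank1Residual.X9.bsdp_of_mu_eq_zero W p hBCS hGr h5
    hmodP hmodL hGZK hX9c hr ?_ ?_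
  · intro κ γ hκ hγ hγ' D
    exact hGrμ W p κ γ hκ hγ hirr D (hBCS W p κ γ f₀ hp hgood hord hirr hκ hγ hγ' hf₀ D).1
  · intro _ f hf ϖ hϖ
    obtain ⟨n, hn⟩ := hA W p f hX9 hf
    refine ⟨n, ?_⟩
    rw [PowerSeries.coeff_C_mul, norm_mul,
      Literature.NumberTheory.EllipticCurves.Rank1Residual.norm_periodRatio_eq_one h5 W p hp hgood hirr
        f hf ϖ hϖ, one_mul]
    exact hn

end Summit.BirchSwinnertonDyer.BirchSwinnertonDyer.Rank1Residual

end
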